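import Summits.Ventures.QEC.Census.BB.BB288.CoverL21Q13C0
import Summits.Ventures.QEC.Census.BB.BB288.CoverL21Q13C1
import Summits.Ventures.QEC.Census.BB.BB288.CoverL21Q13C2
import Summits.Ventures.QEC.Census.BB.BB288.CoverL21Q13C3
import Summits.Ventures.QEC.Census.BB.BB288.CoverL21Q13C4
import Summits.Ventures.QEC.Census.BB.BB288.CoverL21Q13C5
import Summits.Ventures.QEC.Census.BB.BB288.CoverL21Q13C6
import Summits.Ventures.QEC.Census.BB.BB288.CoverL21V00
import HarnessLib

set_option Elab.async false

/-!
# `[[288,12,18]]` cover certificate — level-2→1 problem 13: the scan ASSEMBLED from its 41 first-position chunks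
(`reaches_of_chunks`) and the problem's `cosetOK` verdict (`cosetOK_of_structD_reaches`).
-/

namespace Summit.Ventures.QEC.Census.BB288Cover

open Summit.Ventures.QEC.Census

/-- The enumeration of problem 13 reaches every selection of ≤ 5 cleared rows from the offset (41 chunk verdicts glued). -/
theorem q13_reaches_lit : Reaches (bzLeaf 5 q13.allow) (rowPos q13Gc 0) 5 (2 ^ 41) q13c0 := by
  refine reaches_of_chunks (rowPos q13Gc 0) 4 (2 ^ 41) q13c0 q13_root_lit ?_
  intro i hi
  have hlen : (rowPos q13Gc 0).length = 41 := by rw [length_rowPos]; decide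
  have hi' : i < 41 := hlen ▸ hi
  interval_cases i
  · exact (scan_eq_true_iff_reaches _ _ _ _ _).1 q13_chunk0
  · exact (scan_eq_true_iff_reaches _ _ _ _ _).1 q13_chunk1
  · exact (scan_eq_true_iff_reaches _ _ _ _ _).1 q13_chunk2
  · exact (scan_eq_true_iff_reaches _ _ _ _ _).1 q13_chunk3
  · exact (scan_eq_true_iff_reaches _ _ _ _ _).1 q13_chunk4
  · exact (scan_eq_true_iff_reaches _ _ _ _ _).1 q13_chunk5
  · exact (scan_eq_true_iff_reaches _ _ _ _ _).1 q13_chunk6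
  · exact (scan_eq_true_iff_reaches _ _ _ _ _).1 q13_chunk7
  · exact (scan_eq_true_iff_reaches _ _ _ _ _).1 q13_chunk8
  · exact (scan_eq_true_iff_reaches _ _ _ _ _).1 q13_chunk9
  · exact (scan_eq_true_iff_reaches _ _ _ _ _).1 q13_chunk10
  · exact (scan_eq_true_iff_reaches _ _ _ _ _).1 q13_chunk11
  · exact (scan_eq_true_iff_reaches _ _ _ _ _).1 q13_chunk12
  · exact (scan_eq_true_iff_reaches _ _ _ _ _).1 q13_chunk13
  · exact (scan_eq_true_iff_reaches _ _ _ _ _).1 q13_chunk14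
  · exact (scan_eq_true_iff_reaches _ _ _ _ _).1 q13_chunk15
  · exact (scan_eq_true_iff_reaches _ _ _ _ _).1 q13_chunk16
  · exact (scan_eq_true_iff_reaches _ _ _ _ _).1 q13_chunk17
  · exact (scan_eq_true_iff_reaches _ _ _ _ _).1 q13_chunk18
  · exact (scan_eq_true_iff_reaches _ _ _ _ _).1 q13_chunk19
  · exact (scan_eq_true_iff_reaches _ _ _ _ _).1 q13_chunk20
  · exact (scan_eq_true_iff_reaches _ _ _ _ _).1 q13_chunk21
  · exact (scan_eq_true_iff_reaches _ _ _ _ _).1 q13_chunk22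
  · exact (scan_eq_true_iff_reaches _ _ _ _ _).1 q13_chunk23
  · exact (scan_eq_true_iff_reaches _ _ _ _ _).1 q13_chunk24
  · exact (scan_eq_true_iff_reaches _ _ _ _ _).1 q13_chunk25
  · exact (scan_eq_true_iff_reaches _ _ _ _ _).1 q13_chunk26
  · exact (scan_eq_true_iff_reaches _ _ _ _ _).1 q13_chunk27
  · exact (scan_eq_true_iff_reaches _ _ _ _ _).1 q13_chunk28
  · exact (scan_eq_true_iff_reaches _ _ _ _ _).1 q13_chunk29
  · exact (scan_eq_true_iff_reaches _ _ _ _ _).1 q13_chunk30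
  · exact (scan_eq_true_iff_reaches _ _ _ _ _).1 q13_chunk31
  · exact (scan_eq_true_iff_reaches _ _ _ _ _).1 q13_chunk32
  · exact (scan_eq_true_iff_reaches _ _ _ _ _).1 q13_chunk33
  · exact (scan_eq_true_iff_reaches _ _ _ _ _).1 q13_chunk34
  · exact (scan_eq_true_iff_reaches _ _ _ _ _).1 q13_chunk35
  · exact (scan_eq_true_iff_reaches _ _ _ _ _).1 q13_chunk36
  · exact (scan_eq_true_iff_reaches _ _ _ _ _).1 q13_chunk37
  · exact (scan_eq_true_iff_reaches _ _ _ _ _).1 q13_chunk38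
  · exact (scan_eq_true_iff_reaches _ _ _ _ _).1 q13_chunk39
  · exact (scan_eq_true_iff_reaches _ _ _ _ _).1 q13_chunk40

/-- The same in the checker's own terms (`q13Gc_eq`). -/
theorem q13_reaches : Reaches (bzLeaf q13.f q13.allow) (rowPos (q13.G.map (clr q13.U)) 0) q13.f (2 ^ q13.G.length)
    (clr q13.U q13.y0) := by
  obtain ⟨hG, hc, hk, hf⟩ := q13Gc_eq
  rw [hG, hc, hk, hf]
  exact q13_reaches_lit

/-- **Verdict of level-2→1 problem 13** (`cosetOK`), from the structural verdict and the chunked enumeration. -/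
theorem q13_ok : cosetOK 72 Hq2 D2 q13 = true :=
  cosetOK_of_structD_reaches D2_ker q13_struct q13_reaches

end Summit.Ventures.QEC.Census.BB288Cover
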